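import Literature.NumberTheory.GaloisRepresentations.DecompositionFieldRigidity
import Mathlib.GroupTheory.Commensurable
import HarnessLib

/-!
# Distinct primes of `K̄` have non-commensurable decomposition groups; commensurable terminality

Topic `NumberTheory/GaloisRepresentations`; theorems only (no definition, no named fact), sequel of
`DecompositionFieldRigidity.lean` (notation as there: `K` a number field, `v` a finite place,
`K_v = v.adicCompletion K`, `ι : K̄ → \bar K_v`, `res : Γ_{K_v} → Γ_K`, `𝔓₀ = adicCompletionPrime K v`,
`D_{𝔓₀} = res (Γ_{K_v})`, `Z₀ = ι⁻¹(K_v)` the decomposition field).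

* **`smul_adicCompletionPrime_eq_of_decompositionField`** — if `σ ∈ Γ_K` maps `Z₀` into the
  algebraic elements of a finite extension of `K_v`, then `σ 𝔓₀ = 𝔓₀` (rigidity makes `𝔓₀` and
  `σ 𝔓₀` agree on the decomposition field of `σ 𝔓₀`, above which `σ 𝔓₀` is the only prime —
  Mathlib `Algebra.IsInvariant.exists_smul_of_under_eq_of_profinite`);
* **`smul_adicCompletionPrime_eq_of_relIndex_ne_zero`**, `smul_eq_of_relIndex_ne_zero_of_mem_primesAbove`
  — if `D_{σ 𝔓} ∩ D_𝔓` has finite index in `D_𝔓` then `σ 𝔓 = 𝔓` (`𝔓 ∣ v` any prime of `\bar ℤ_K`):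
  distinct primes of `K̄` have non-commensurable decomposition groups — the number-field case of
  [NSW] Cor. 12.1.3 / F. K. Schmidt's theorem, here WITHOUT Henselian valuation theory or class
  field theory;
* **`commensurator_decompositionSubgroup_adicCompletionPrime`**,
  **`commensurator_decompositionSubgroup_eq_of_mem_primesAbove`** — decomposition groups of
  nonarchimedean primes of `K̄` are commensurably terminal in `Γ_K`, `C_{Γ_K}(D_𝔓) = D_𝔓`
  (Mochizuki, *The absolute anabelian geometry of hyperbolic curves* (2004), Thm. 1.1.1 (i):
  "a formal consequence of [NSW], Corollary 12.1.3").

## References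

* J. Neukirch, A. Schmidt, K. Wingberg, *Cohomology of Number Fields*, Grundlehren 323 (2nd ed.
  2008), Cor. 12.1.3. [NeukirchSchmidtWingberg2008]
* S. Mochizuki, *The absolute anabelian geometry of hyperbolic curves*, Galois theory and modular
  forms, Kluwer (2004), Thm. 1.1.1 (i). [MochizukiAbsAnab2004]
* J. Neukirch, *Algebraic Number Theory*, Grundlehren 322 (1999), Ch. II §9 (9.6). [NeukirchANT1999]
-/

noncomputable section

open scoped NumberField Pointwise Valued
open Field IsDedekindDomain Polynomial

universe u

namespace Literature.NumberTheory.GaloisRepresentations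

/-! ### Two group-theoretic trivialities -/

/-- The conjugation action of `ConjAct G` and of `MulAut.conj` on subgroups agree. [folklore] -/
private theorem conjAct_smul_subgroup_eq {G : Type*} [Group G] (g : G) (H : Subgroup G) :
    ConjAct.toConjAct g • H = MulAut.conj g • H := rfl

/-- The relative index is invariant under simultaneous conjugation
(Mathlib `Subgroup.quotConjEquiv`). [folklore] -/
private theorem relIndex_conjAct_smul {G : Type*} [Group G] (g : ConjAct G) (H L : Subgroup G) :
    (g • H).relIndex (g • L) = H.relIndex L :=
  (Nat.card_congr (Subgroup.quotConjEquiv H L g)).symm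

variable (K : Type u) [Field K] [NumberField K] (v : HeightOneSpectrum (𝓞 K))

/-! ### Distinct primes have non-commensurable decomposition groups -/

/-- **`𝔓₀` and `σ 𝔓₀` coincide as soon as `σ` maps the decomposition field of `𝔓₀` into the
algebraic elements of a finite extension of `K_v`.**  With `k'` and `hσ` as in
`spectralNorm_absClosureEmbedding_smul_eq`: `σ • 𝔓₀ = 𝔓₀`.  By rigidity, `𝔓₀` and `σ 𝔓₀` have
the same contraction to the fixed ring of `D_{σ 𝔓₀}` (whose elements lie in `σ Z₀`); but `σ 𝔓₀` is
the only prime of `\bar ℤ_K` above that contraction (transitivity of `D_{σ𝔓₀}` on the primes above,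
Mathlib `Algebra.IsInvariant.exists_smul_of_under_eq_of_profinite`).
[cite: NeukirchSchmidtWingberg2008, Cor. 12.1.3] -/
theorem smul_adicCompletionPrime_eq_of_decompositionField (σ : absoluteGaloisGroup K)
    (k' : IntermediateField (v.adicCompletion K) (AlgebraicClosure (v.adicCompletion K)))
    [FiniteDimensional (v.adicCompletion K) k']
    (hσ : ∀ x : AlgebraicClosure K,
      absClosureEmbedding K (v.adicCompletion K) x ∈
          Set.range (algebraMap (v.adicCompletion K) (AlgebraicClosure (v.adicCompletion K))) →
        absClosureEmbedding K (v.adicCompletion K) (σ • x) ∈ k') :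
    σ • adicCompletionPrime K v = adicCompletionPrime K v := by
  classical
  set 𝔓 : Ideal (absIntegers (𝓞 K) K) := adicCompletionPrime K v with h𝔓
  -- the decomposition group `G' = D_{σ • 𝔓}` as a profinite group acting on `\bar ℤ_K`
  set G' : Subgroup (absoluteGaloisGroup K) := (σ • 𝔓).decompositionSubgroup (absoluteGaloisGroup K)
    with hG'
  have hG'closed : IsClosed (G' : Set (absoluteGaloisGroup K)) :=
    absIntegers.isClosed_decompositionSubgroup_holds (R := 𝓞 K) (K := K) (σ • 𝔓)
  haveI : CompactSpace G' := isCompact_iff_compactSpace.mp hG'closed.isCompact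
  letI : TopologicalSpace (absIntegers (𝓞 K) K) := ⊥
  haveI : DiscreteTopology (absIntegers (𝓞 K) K) := ⟨rfl⟩
  haveI : ContinuousSMul (absoluteGaloisGroup K) (absIntegers (𝓞 K) K) :=
    absIntegers.continuousSMul (𝓞 K)
  haveI : Algebra.IsInvariant (FixedPoints.subring (absIntegers (𝓞 K) K) G') (absIntegers (𝓞 K) K)
      G' := ⟨fun b hb => ⟨⟨b, hb⟩, rfl⟩⟩
  haveI : SMulCommClass G' (FixedPoints.subring (absIntegers (𝓞 K) K) G') (absIntegers (𝓞 K) K) :=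
    ⟨fun g a b => by
      show g • ((a : absIntegers (𝓞 K) K) * b) = (a : absIntegers (𝓞 K) K) * g • b
      rw [smul_mul', show g • (a : absIntegers (𝓞 K) K) = a from a.2 g]⟩
  -- `res τ ∈ D_𝔓`, and its conjugate `σ (res τ) σ⁻¹ ∈ G'`
  have hconj : ∀ τ : absoluteGaloisGroup (v.adicCompletion K),
      σ * absGaloisRestrict K (v.adicCompletion K) τ * σ⁻¹ ∈ G' := by
    intro τ
    have hD : absGaloisRestrict K (v.adicCompletion K) τ ∈
        𝔓.decompositionSubgroup (absoluteGaloisGroup K) := by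
      rw [h𝔓, decompositionSubgroup_adicCompletionPrime_eq_range]
      exact ⟨τ, rfl⟩
    rw [hG', Ideal.decompositionSubgroup_smul (absoluteGaloisGroup K) 𝔓 σ]
    exact ⟨absGaloisRestrict K (v.adicCompletion K) τ, hD, rfl⟩
  -- elements of the fixed ring `A' = \bar ℤ_K ^ {G'}` lie in `σ Z₀`: `ι (σ⁻¹ a) ∈ K_v`
  have hAZ : ∀ a : FixedPoints.subring (absIntegers (𝓞 K) K) G',
      absClosureEmbedding K (v.adicCompletion K)
          (σ⁻¹ • ((a : absIntegers (𝓞 K) K) : AlgebraicClosure K)) ∈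
        Set.range (algebraMap (v.adicCompletion K) (AlgebraicClosure (v.adicCompletion K))) := by
    rintro ⟨a, ha⟩
    refine mem_range_of_forall_absGaloisRestrict_smul_eq K v fun τ => ?_
    have hfix := ha ⟨_, hconj τ⟩
    have h2 : ((((⟨_, hconj τ⟩ : G') • a : absIntegers (𝓞 K) K)) : AlgebraicClosure K) =
        (σ * absGaloisRestrict K (v.adicCompletion K) τ * σ⁻¹) • (a : AlgebraicClosure K) := rfl
    rw [hfix, mul_smul, mul_smul] at h2
    -- `a = σ • (res τ • (σ⁻¹ • a))`
    have h3 := congrArg (σ⁻¹ • ·) h2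
    simp only [inv_smul_smul] at h3
    exact h3.symm
  -- the primes `σ • 𝔓` and `𝔓` contract to the same prime of `A'`
  have hunder : (σ • 𝔓).under (FixedPoints.subring (absIntegers (𝓞 K) K) G') =
      𝔓.under (FixedPoints.subring (absIntegers (𝓞 K) K) G') := by
    ext a
    rw [Ideal.under_def, Ideal.under_def, Ideal.mem_comap, Ideal.mem_comap,
      Ideal.mem_pointwise_smul_iff_inv_smul_mem]
    change σ⁻¹ • (a : absIntegers (𝓞 K) K) ∈ 𝔓 ↔ (a : absIntegers (𝓞 K) K) ∈ 𝔓
    rw [h𝔓, mem_adicCompletionPrime_iff, mem_adicCompletionPrime_iff, integralClosure.coe_smul]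
    have key := spectralNorm_absClosureEmbedding_smul_eq K v σ k' hσ (hAZ a)
    rw [smul_inv_smul] at key
    rw [key]
  -- transitivity of `G'` on the primes above: `𝔓 = g • (σ • 𝔓)` with `g ∈ G' = Stab (σ • 𝔓)`
  haveI : (σ • 𝔓).IsPrime := Ideal.IsPrime.smul σ
  obtain ⟨g, hg⟩ := Algebra.IsInvariant.exists_smul_of_under_eq_of_profinite
    (A := FixedPoints.subring (absIntegers (𝓞 K) K) G') (G := G') (σ • 𝔓) 𝔓 hunder
  have hg' : 𝔓 = (g : absoluteGaloisGroup K) • (σ • 𝔓) := hg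
  have hgstab : (g : absoluteGaloisGroup K) • (σ • 𝔓) = σ • 𝔓 :=
    Ideal.mem_decompositionSubgroup_iff.mp g.2
  rw [hgstab] at hg'
  exact hg'.symm

/-- **Distinct primes have non-commensurable decomposition groups** ([NSW] Cor. 12.1.3 for the
primes of `K̄` above `v`): if `D_{σ 𝔓₀} ∩ D_{𝔓₀}` has finite index in `D_{𝔓₀}` then `σ 𝔓₀ = 𝔓₀`.
The closed finite-index subgroup pulls back under `res : Γ_{K_v} ⥲ D_{𝔓₀}` to an open subgroup
`Gal(\bar K_v / k')`, `k'/K_v` finite, and `σ` maps the decomposition field `ι⁻¹(K_v)` into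
`ι⁻¹(k')`; conclude by `smul_adicCompletionPrime_eq_of_decompositionField`.
[cite: NeukirchSchmidtWingberg2008, Cor. 12.1.3] -/
theorem smul_adicCompletionPrime_eq_of_relIndex_ne_zero (σ : absoluteGaloisGroup K)
    (h : ((σ • adicCompletionPrime K v).decompositionSubgroup (absoluteGaloisGroup K)).relIndex
      ((adicCompletionPrime K v).decompositionSubgroup (absoluteGaloisGroup K)) ≠ 0) :
    σ • adicCompletionPrime K v = adicCompletionPrime K v := by
  classical
  set 𝔓 : Ideal (absIntegers (𝓞 K) K) := adicCompletionPrime K v with h𝔓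
  haveI : CharZero (v.adicCompletion K) :=
    charZero_of_injective_algebraMap (algebraMap K (v.adicCompletion K)).injective
  haveI : IsGalois (v.adicCompletion K) (AlgebraicClosure (v.adicCompletion K)) := {}
  -- pull back `D_{σ𝔓}` to `Γ_{K_v}`
  set H : Subgroup (absoluteGaloisGroup (v.adicCompletion K)) :=
    ((σ • 𝔓).decompositionSubgroup (absoluteGaloisGroup K)).comap
      (absGaloisRestrict K (v.adicCompletion K)).toMonoidHom with hH
  have hindex : H.index ≠ 0 := by
    rw [hH, Subgroup.index_comap, ← decompositionSubgroup_adicCompletionPrime_eq_range]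
    exact h
  haveI : H.FiniteIndex := ⟨hindex⟩
  have hHclosed : IsClosed (H : Set (absoluteGaloisGroup (v.adicCompletion K))) :=
    (absIntegers.isClosed_decompositionSubgroup_holds (R := 𝓞 K) (K := K) (σ • 𝔓)).preimage
      (absGaloisRestrict K (v.adicCompletion K)).continuous
  have hHopen : IsOpen (H : Set (absoluteGaloisGroup (v.adicCompletion K))) :=
    Subgroup.isOpen_of_isClosed_of_finiteIndex H hHclosed
  -- the finite extension `k'` of `K_v` fixed by `H`
  set H' : Subgroup (AlgebraicClosure (v.adicCompletion K) ≃ₐ[v.adicCompletion K]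
      AlgebraicClosure (v.adicCompletion K)) :=
    H.comap (absoluteGaloisGroup.toAlgEquiv (v.adicCompletion K)).symm.toMonoidHom with hH'
  have hH'open : IsOpen (H' : Set (AlgebraicClosure (v.adicCompletion K) ≃ₐ[v.adicCompletion K]
      AlgebraicClosure (v.adicCompletion K))) := hHopen
  set k' : IntermediateField (v.adicCompletion K) (AlgebraicClosure (v.adicCompletion K)) :=
    IntermediateField.fixedField H' with hk'
  haveI : FiniteDimensional (v.adicCompletion K) k' := by
    rw [← InfiniteGalois.isOpen_iff_finite]
    exact Subgroup.isOpen_mono ((IntermediateField.le_iff_le (H := H') (K := k')).mp le_rfl) hH'open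
  -- `σ` maps `Z₀` into `ι⁻¹(k')`
  have hσ : ∀ x : AlgebraicClosure K,
      absClosureEmbedding K (v.adicCompletion K) x ∈
          Set.range (algebraMap (v.adicCompletion K) (AlgebraicClosure (v.adicCompletion K))) →
        absClosureEmbedding K (v.adicCompletion K) (σ • x) ∈ k' := by
    intro x hx
    rw [hk', IntermediateField.mem_fixedField_iff]
    intro f hf
    have hfH : absGaloisRestrict K (v.adicCompletion K)
        ((absoluteGaloisGroup.toAlgEquiv (v.adicCompletion K)).symm f) ∈
        (σ • 𝔓).decompositionSubgroup (absoluteGaloisGroup K) := hf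
    rw [Ideal.decompositionSubgroup_smul (absoluteGaloisGroup K) 𝔓 σ,
      Subgroup.mem_pointwise_smul_iff_inv_smul_mem, MulAut.smul_def, MulAut.conj_inv_apply, h𝔓,
      decompositionSubgroup_adicCompletionPrime_eq_range] at hfH
    obtain ⟨τ', hτ'⟩ := hfH
    have hτ'' : absGaloisRestrict K (v.adicCompletion K) τ' =
        σ⁻¹ * absGaloisRestrict K (v.adicCompletion K)
          ((absoluteGaloisGroup.toAlgEquiv (v.adicCompletion K)).symm f) * σ := hτ'
    -- `res ((toAlgEquiv k).symm f) = σ * res τ' * σ⁻¹`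
    have hres : absGaloisRestrict K (v.adicCompletion K)
        ((absoluteGaloisGroup.toAlgEquiv (v.adicCompletion K)).symm f) =
        σ * absGaloisRestrict K (v.adicCompletion K) τ' * σ⁻¹ := by
      rw [hτ'']; group
    have h1 : f (absClosureEmbedding K (v.adicCompletion K) (σ • x)) =
        ((absoluteGaloisGroup.toAlgEquiv (v.adicCompletion K)).symm f) •
          absClosureEmbedding K (v.adicCompletion K) (σ • x) :=
      (absoluteGaloisGroup.toAlgEquiv_symm_apply f _).symm
    rw [h1, ← absGaloisRestrict_apply_smul, hres, mul_smul, mul_smul, inv_smul_smul,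
      absGaloisRestrict_smul_eq_of_mem_range K v τ' hx]
  exact smul_adicCompletionPrime_eq_of_decompositionField K v σ k' hσ

/-! ### Commensurable terminality of decomposition groups -/

omit [NumberField K] in
/-- `g ∈ C_{Γ_K}(D_𝔓)` means in particular that `D_{g 𝔓} ∩ D_𝔓` has finite index in `D_𝔓`
(`D_{g 𝔓} = g D_𝔓 g⁻¹`). [folklore] -/
private theorem relIndex_decompositionSubgroup_smul_ne_zero_of_mem_commensurator
    {𝔓 : Ideal (absIntegers (𝓞 K) K)} {g : absoluteGaloisGroup K}
    (hg : g ∈ Subgroup.Commensurable.commensurator (𝔓.decompositionSubgroup (absoluteGaloisGroup K))) :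
    ((g • 𝔓).decompositionSubgroup (absoluteGaloisGroup K)).relIndex
      (𝔓.decompositionSubgroup (absoluteGaloisGroup K)) ≠ 0 := by
  rw [Subgroup.Commensurable.commensurator_mem_iff] at hg
  rw [Ideal.decompositionSubgroup_smul (absoluteGaloisGroup K) 𝔓 g, ← conjAct_smul_subgroup_eq]
  exact hg.1

omit [NumberField K] in
/-- `D_𝔓` is contained in its own commensurator (every `h ∈ D_𝔓` normalises `D_𝔓`). [folklore] -/
private theorem decompositionSubgroup_le_commensurator (𝔓 : Ideal (absIntegers (𝓞 K) K)) :
    𝔓.decompositionSubgroup (absoluteGaloisGroup K) ≤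
      Subgroup.Commensurable.commensurator (𝔓.decompositionSubgroup (absoluteGaloisGroup K)) := by
  intro g hg
  rw [Subgroup.Commensurable.commensurator_mem_iff]
  have : ConjAct.toConjAct g • 𝔓.decompositionSubgroup (absoluteGaloisGroup K) =
      𝔓.decompositionSubgroup (absoluteGaloisGroup K) := by
    rw [conjAct_smul_subgroup_eq, ← Ideal.decompositionSubgroup_smul (absoluteGaloisGroup K) 𝔓 g,
      Ideal.mem_decompositionSubgroup_iff.mp hg]
  rw [this]

/-- **Commensurable terminality of `D_{𝔓₀}`**: the commensurator in `Γ_K` of the decomposition group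
of the prime `𝔓₀` of `K̄` above `v` cut out by `K̄ → \bar K_v` is `D_{𝔓₀}` itself.  Mochizuki,
*The absolute anabelian geometry of hyperbolic curves* (2004), Thm. 1.1.1 (i) ("`C_{G_F}(G_𝔭) = G_𝔭`
... a formal consequence of [NSW], Corollary 12.1.3"). [cite: MochizukiAbsAnab2004, Thm 1.1.1 (i) p.6] -/
theorem commensurator_decompositionSubgroup_adicCompletionPrime :
    Subgroup.Commensurable.commensurator
        ((adicCompletionPrime K v).decompositionSubgroup (absoluteGaloisGroup K)) =
      (adicCompletionPrime K v).decompositionSubgroup (absoluteGaloisGroup K) := by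
  refine le_antisymm (fun g hg => ?_) (decompositionSubgroup_le_commensurator K _)
  rw [Ideal.mem_decompositionSubgroup_iff]
  exact smul_adicCompletionPrime_eq_of_relIndex_ne_zero K v g
    (relIndex_decompositionSubgroup_smul_ne_zero_of_mem_commensurator K hg)

-- the pointwise `MulAction` of `Γ_K` on the ideals of `\bar ℤ_K` is slow to synthesise
set_option synthInstance.maxHeartbeats 160000 in
/-- **Distinct primes have non-commensurable decomposition groups**, for an arbitrary prime `𝔓`
of `\bar ℤ_K` above `v` (all such primes are `Γ_K`-conjugate to `𝔓₀`,
`exists_smul_eq_of_mem_primesAbove_holds`, and relative indices are conjugation-invariant): if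
`D_{σ 𝔓} ∩ D_𝔓` has finite index in `D_𝔓` then `σ 𝔓 = 𝔓`.  [NSW] Cor. 12.1.3 (number-field case,
primes of `K̄`). [cite: NeukirchSchmidtWingberg2008, Cor. 12.1.3] -/
theorem smul_eq_of_relIndex_ne_zero_of_mem_primesAbove {𝔓 : Ideal (absIntegers (𝓞 K) K)}
    (h𝔓 : 𝔓 ∈ v.primesAbove) (σ : absoluteGaloisGroup K)
    (h : ((σ • 𝔓).decompositionSubgroup (absoluteGaloisGroup K)).relIndex
      (𝔓.decompositionSubgroup (absoluteGaloisGroup K)) ≠ 0) :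
    σ • 𝔓 = 𝔓 := by
  obtain ⟨γ, hγ⟩ := HeightOneSpectrum.exists_smul_eq_of_mem_primesAbove_holds
    (adicCompletionPrime_mem_primesAbove K v) h𝔓
  rw [← hγ] at h ⊢
  -- conjugate by `γ⁻¹`: `D_{γ⁻¹ σ γ • 𝔓₀} ∩ D_{𝔓₀}` has finite index in `D_{𝔓₀}`
  have e1 : σ • γ • adicCompletionPrime K v = γ • ((γ⁻¹ * σ * γ) • adicCompletionPrime K v) := by
    rw [mul_smul, mul_smul, smul_inv_smul]
  have h' : (((γ⁻¹ * σ * γ) • adicCompletionPrime K v).decompositionSubgroup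
        (absoluteGaloisGroup K)).relIndex
      ((adicCompletionPrime K v).decompositionSubgroup (absoluteGaloisGroup K)) ≠ 0 := by
    rw [e1, Ideal.decompositionSubgroup_smul (absoluteGaloisGroup K) _ γ,
      Ideal.decompositionSubgroup_smul (absoluteGaloisGroup K) (adicCompletionPrime K v) γ,
      ← conjAct_smul_subgroup_eq, ← conjAct_smul_subgroup_eq, relIndex_conjAct_smul] at h
    exact h
  rw [e1, smul_adicCompletionPrime_eq_of_relIndex_ne_zero K v _ h']

/-- **Commensurable terminality of decomposition groups** for an arbitrary prime `𝔓` of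
`\bar ℤ_K` above `v`: `C_{Γ_K}(D_𝔓) = D_𝔓`.  Mochizuki, *The absolute anabelian geometry of
hyperbolic curves* (2004), Thm. 1.1.1 (i); [NSW] Cor. 12.1.3.
[cite: MochizukiAbsAnab2004, Thm 1.1.1 (i) p.6] -/
theorem commensurator_decompositionSubgroup_eq_of_mem_primesAbove
    {𝔓 : Ideal (absIntegers (𝓞 K) K)} (h𝔓 : 𝔓 ∈ v.primesAbove) :
    Subgroup.Commensurable.commensurator (𝔓.decompositionSubgroup (absoluteGaloisGroup K)) =
      𝔓.decompositionSubgroup (absoluteGaloisGroup K) := by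
  refine le_antisymm (fun g hg => ?_) (decompositionSubgroup_le_commensurator K _)
  rw [Ideal.mem_decompositionSubgroup_iff]
  exact smul_eq_of_relIndex_ne_zero_of_mem_primesAbove K v h𝔓 g
    (relIndex_decompositionSubgroup_smul_ne_zero_of_mem_commensurator K hg)

end Literature.NumberTheory.GaloisRepresentations
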